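import Summits.QuantumAdvantage.AdviceFreeQNC0.DWalkLetters
import HarnessLib

/-!
# Cell qa-qnc0 (rung F-Q2-odd, `p = 3`): fibres of the block word in `S₃` (ROUND-15 formalisation map L2)

Planner qa-qnc0-p1 g16, `ROUND-15.md` §1 ("MIXING: `|6·#fibre(g) − 2^L| ≤ 4`"), for THEOREM A′ `PredHardDWB3`.
For a constant weight `κ₀ ≠ 0` and block length `L`, with the letters/words of `DWalkLetters.lean`
(`blockPerm κ₀ b = wp (fun _ => κ₀) (bN b) 0 L`, affine data `(blockSgn b, blockTr κ₀ b)`):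

* `sgnTrCount_succ` — appending the last letter: `c_{L+1}(e', t') = H_L(t' − κ₀ e')` (the new letter enters only
  through the new sign), `trCount_succ` — `H_{L+1}(t) = 2^L − H_L(t)`, hence `three_mul_trCount` — `|3·H_L(t) − 2^L| ≤ 2`;
* **`six_mul_card_fib_le` / `two_pow_le_six_mul_card_fib`** — `2^L − 4 ≤ 6·#fib_L(g) ≤ 2^L + 4` for every `g ∈ S₃`,
  `L ≥ 1`; `fib_nonempty` (`L ≥ 3`); `mem_fib_iff`.

WHAT THIS IS NOT: no gauge/transport yet; separation NOT moved.
-/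

noncomputable section

namespace Summit.QuantumAdvantage.AdviceFreeQNC0

namespace DWalk

open Finset Equiv

/-! ### Fibres of the block word for a constant weight (L2) -/

section Fibres

variable (κ₀ : ZMod 3) {L : ℕ}

/-- A block content of length `L` as an ℕ-indexed bit sequence. -/
def bN (b : Fin L → Bool) (i : ℕ) : Bool := if h : i < L then b ⟨i, h⟩ else false

/-- The block word (constant weight `κ₀`). -/
def blockPerm (b : Fin L → Bool) : Perm (ZMod 3) := wp (fun _ => κ₀) (bN b) 0 L

/-- Its sign. -/
def blockSgn (b : Fin L → Bool) : ZMod 3 := sgnW (bN b) 0 L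

/-- Its translation. -/
def blockTr (b : Fin L → Bool) : ZMod 3 := trW (fun _ => κ₀) (bN b) 0 L

/-- The block word is affine with data `(blockSgn, blockTr)`. -/
theorem isAff_blockPerm (b : Fin L → Bool) : IsAff (blockPerm κ₀ b) (blockSgn b) (blockTr κ₀ b) :=
  isAff_wp _ _ 0 L

/-- The fibre of `g ∈ S₃`: block contents whose word is `g`. -/
def fib (L : ℕ) (g : Perm (ZMod 3)) : Finset (Fin L → Bool) :=
  univ.filter fun b : Fin L → Bool => blockPerm κ₀ b = g

/-- The translation counts `H_L(t) = #{b : blockTr b = t}`. -/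
def trCount (L : ℕ) (t : ZMod 3) : ℕ := (univ.filter fun b : Fin L → Bool => blockTr κ₀ b = t).card

/-- The signed counts `c_L(e,t) = #{b : blockSgn b = e ∧ blockTr b = t}`. -/
def sgnTrCount (L : ℕ) (e t : ZMod 3) : ℕ :=
  (univ.filter fun b : Fin L → Bool => blockSgn b = e ∧ blockTr κ₀ b = t).card

variable {κ₀}

/-- `snoc` adds the last letter: sign. -/
theorem blockSgn_snoc (b : Fin L → Bool) (β : Bool) :
    blockSgn (Fin.snoc b β : Fin (L + 1) → Bool) = blockSgn b * yt β := by
  unfold blockSgn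
  rw [sgnW_succ, Nat.zero_add]
  have h1 : sgnW (bN (Fin.snoc b β : Fin (L + 1) → Bool)) 0 L = sgnW (bN b) 0 L :=
    sgnW_congr fun t ht => by simp [bN, ht, show t < L + 1 by omega, Fin.snoc, Fin.castLT]
  have h2 : bN (Fin.snoc b β : Fin (L + 1) → Bool) L = β := by simp [bN, Fin.snoc]
  rw [h1, h2]

/-- `snoc` adds the last letter: translation. -/
theorem blockTr_snoc (b : Fin L → Bool) (β : Bool) :
    blockTr κ₀ (Fin.snoc b β : Fin (L + 1) → Bool) = blockTr κ₀ b + κ₀ * (blockSgn b * yt β) := by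
  have hs := blockSgn_snoc b β
  unfold blockTr
  unfold blockSgn at hs
  rw [trW_succ, hs]
  have h1 : trW (fun _ => κ₀) (bN (Fin.snoc b β : Fin (L + 1) → Bool)) 0 L = trW (fun _ => κ₀) (bN b) 0 L :=
    trW_congr fun t ht => ⟨rfl, by simp [bN, ht, show t < L + 1 by omega, Fin.snoc, Fin.castLT]⟩
  rw [h1]
  rfl

/-- The block sign is `±1`. -/
theorem blockSgn_eq_or (b : Fin L → Bool) : blockSgn b = 1 ∨ blockSgn b = -1 := sgnW_eq_or _ 0 L

/-- Counting over `{0,1}^{L+1}` by the last coordinate. -/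
private theorem card_filter_snoc (P : (Fin (L + 1) → Bool) → Prop) [DecidablePred P] :
    (univ.filter P).card =
      (univ.filter fun b : Fin L → Bool => P (Fin.snoc b false)).card +
      (univ.filter fun b : Fin L → Bool => P (Fin.snoc b true)).card := by
  rw [Finset.card_filter, Finset.card_filter, Finset.card_filter,
    ← Fintype.sum_equiv (Fin.snocEquiv fun _ : Fin (L + 1) => Bool) _ _ (fun _ => rfl),
    Fintype.sum_prod_type, Fintype.sum_bool, add_comm]
  rfl

/-- **Recursion for the signed counts**: `c_{L+1}(e', t') = H_L(t' − κ₀ e')` for `e' = ±1`. -/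
theorem sgnTrCount_succ {e' : ZMod 3} (he : e' = 1 ∨ e' = -1) (t' : ZMod 3) :
    sgnTrCount κ₀ (L + 1) e' t' = trCount κ₀ L (t' - κ₀ * e') := by
  unfold sgnTrCount trCount
  rw [card_filter_snoc]
  simp only [blockSgn_snoc, blockTr_snoc]
  rw [← Finset.card_union_of_disjoint]
  · congr 1
    ext b
    simp only [mem_union, mem_filter, mem_univ, true_and]
    have key : ∀ s e t tr κ : ZMod 3, (s = 1 ∨ s = -1) → (e = 1 ∨ e = -1) →
        (((s * yt false = e ∧ tr + κ * (s * yt false) = t) ∨ (s * yt true = e ∧ tr + κ * (s * yt true) = t))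
          ↔ tr = t - κ * e) := by decide
    exact key _ _ _ _ _ (blockSgn_eq_or b) he
  · rw [Finset.disjoint_filter]
    rintro b _ ⟨h1, _⟩ ⟨h2, _⟩
    have key : ∀ s e : ZMod 3, (s = 1 ∨ s = -1) → s * yt false = e → s * yt true = e → False := by decide
    exact key _ _ (blockSgn_eq_or b) h1 h2

/-- `H_L = c_L(1, ·) + c_L(−1, ·)`. -/
theorem trCount_eq_add (L : ℕ) (t : ZMod 3) :
    trCount κ₀ L t = sgnTrCount κ₀ L 1 t + sgnTrCount κ₀ L (-1) t := by
  unfold trCount sgnTrCount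
  rw [← Finset.card_union_of_disjoint]
  · congr 1
    ext b
    simp only [mem_filter, mem_univ, true_and, mem_union]
    have key : ∀ s tr t' : ZMod 3, (s = 1 ∨ s = -1) →
        (tr = t' ↔ (s = 1 ∧ tr = t') ∨ (s = -1 ∧ tr = t')) := by decide
    exact key _ _ _ (blockSgn_eq_or b)
  · rw [Finset.disjoint_filter]
    rintro b _ ⟨h1, _⟩ ⟨h2, _⟩
    rw [h1] at h2
    exact absurd h2 (by decide)

/-- The three translation counts partition the cube. -/
theorem trCount_sum (hκ : κ₀ ≠ 0) (L : ℕ) (t : ZMod 3) :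
    trCount κ₀ L t + trCount κ₀ L (t - κ₀) + trCount κ₀ L (t + κ₀) = 2 ^ L := by
  unfold trCount
  have hκ' : κ₀ = 1 ∨ κ₀ = -1 := by
    have : ∀ c : ZMod 3, c ≠ 0 → c = 1 ∨ c = -1 := by decide
    exact this κ₀ hκ
  have key : ∀ s : ZMod 3, (s = t ∨ s = t - κ₀ ∨ s = t + κ₀) ∧
      ¬ (s = t ∧ s = t - κ₀) ∧ ¬ (s = t ∧ s = t + κ₀) ∧ ¬ (s = t - κ₀ ∧ s = t + κ₀) := by
    rcases hκ' with h | h <;> subst h <;> revert t <;> decide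
  rw [← Finset.card_union_of_disjoint, ← Finset.card_union_of_disjoint]
  · have : ((univ.filter fun b : Fin L → Bool => blockTr κ₀ b = t) ∪
        (univ.filter fun b : Fin L → Bool => blockTr κ₀ b = t - κ₀)) ∪
        (univ.filter fun b : Fin L → Bool => blockTr κ₀ b = t + κ₀) = univ := by
      ext b
      simp only [mem_union, mem_filter, mem_univ, true_and, iff_true]
      rcases (key (blockTr κ₀ b)).1 with h | h | h
      · exact Or.inl (Or.inl h)
      · exact Or.inl (Or.inr h)
      · exact Or.inr h
    rw [this, card_univ, Fintype.card_fun, Fintype.card_bool, Fintype.card_fin]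
  · rw [Finset.disjoint_union_left, Finset.disjoint_filter, Finset.disjoint_filter]
    exact ⟨fun b _ h1 h2 => (key _).2.2.1 ⟨h1, h2⟩, fun b _ h1 h2 => (key _).2.2.2 ⟨h1, h2⟩⟩
  · rw [Finset.disjoint_filter]
    exact fun b _ h1 h2 => (key _).2.1 ⟨h1, h2⟩

/-- **Recursion** `H_{L+1}(t) = 2^L − H_L(t)`. -/
theorem trCount_succ (hκ : κ₀ ≠ 0) (L : ℕ) (t : ZMod 3) :
    trCount κ₀ (L + 1) t + trCount κ₀ L t = 2 ^ L := by
  rw [trCount_eq_add, sgnTrCount_succ (Or.inl rfl), sgnTrCount_succ (Or.inr rfl), mul_one, mul_neg, mul_one,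
    sub_neg_eq_add, ← trCount_sum hκ L t]
  ring

/-- **`|3·H_L(t) − 2^L| ≤ 2`** for all `L`. -/
theorem three_mul_trCount (hκ : κ₀ ≠ 0) :
    ∀ (L : ℕ) (t : ZMod 3), (2 : ℤ) ^ L - 2 ≤ 3 * (trCount κ₀ L t : ℤ) ∧ 3 * (trCount κ₀ L t : ℤ) ≤ (2 : ℤ) ^ L + 2
  | 0, t => by
    unfold trCount
    have : (univ.filter fun b : Fin 0 → Bool => blockTr κ₀ b = t).card ≤ 1 := by
      calc (univ.filter fun b : Fin 0 → Bool => blockTr κ₀ b = t).card ≤ (univ : Finset (Fin 0 → Bool)).card :=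
            Finset.card_filter_le _ _
        _ = 1 := by simp
    simp only [pow_zero]
    constructor <;> omega
  | L + 1, t => by
    have h := trCount_succ hκ L t
    obtain ⟨ih1, ih2⟩ := three_mul_trCount hκ L t
    zify at h
    rw [pow_succ]
    constructor <;> linarith

/-- The fibre of an affine `g = (e, t)` is the signed count set. -/
theorem fib_eq_filter {g : Perm (ZMod 3)} {e t : ZMod 3} (hg : IsAff g e t) :
    fib κ₀ L g = univ.filter fun b : Fin L → Bool => blockSgn b = e ∧ blockTr κ₀ b = t := by
  unfold fib
  ext b
  simp only [mem_filter, mem_univ, true_and]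
  constructor
  · intro h
    have h' := isAff_blockPerm κ₀ b
    rw [h] at h'
    exact ⟨((hg.unique h').1).symm, ((hg.unique h').2).symm⟩
  · rintro ⟨h1, h2⟩
    have h' := isAff_blockPerm κ₀ b
    rw [h1, h2] at h'
    exact h'.perm_eq hg

/-- **Fibre sizes (L2)**: `6·#fib_L(g) ≤ 2^L + 4` for every `g ∈ S₃`, `L ≥ 1`, `κ₀ ≠ 0`. -/
theorem six_mul_card_fib_le (hκ : κ₀ ≠ 0) (hL : 1 ≤ L) (g : Perm (ZMod 3)) :
    6 * ((fib κ₀ L g).card : ℤ) ≤ (2 : ℤ) ^ L + 4 := by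
  obtain ⟨L', rfl⟩ : ∃ L', L = L' + 1 := ⟨L - 1, by omega⟩
  obtain ⟨hg, he⟩ := perm_isAff g
  rw [fib_eq_filter hg]
  have h := sgnTrCount_succ (κ₀ := κ₀) (L := L') he (g 0)
  unfold sgnTrCount at h
  rw [h]
  have := (three_mul_trCount hκ L' (g 0 - κ₀ * (g 1 - g 0))).2
  rw [pow_succ]
  linarith

/-- **Fibre sizes (L2)**: `2^L − 4 ≤ 6·#fib_L(g)`. -/
theorem two_pow_le_six_mul_card_fib (hκ : κ₀ ≠ 0) (hL : 1 ≤ L) (g : Perm (ZMod 3)) :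
    (2 : ℤ) ^ L - 4 ≤ 6 * ((fib κ₀ L g).card : ℤ) := by
  obtain ⟨L', rfl⟩ : ∃ L', L = L' + 1 := ⟨L - 1, by omega⟩
  obtain ⟨hg, he⟩ := perm_isAff g
  rw [fib_eq_filter hg]
  have h := sgnTrCount_succ (κ₀ := κ₀) (L := L') he (g 0)
  unfold sgnTrCount at h
  rw [h]
  have := (three_mul_trCount hκ L' (g 0 - κ₀ * (g 1 - g 0))).1
  rw [pow_succ]
  linarith

/-- Every fibre is non-empty once `L ≥ 3`. -/
theorem fib_nonempty (hκ : κ₀ ≠ 0) (hL : 3 ≤ L) (g : Perm (ZMod 3)) : (fib κ₀ L g).Nonempty := by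
  rw [← Finset.card_pos]
  have h := two_pow_le_six_mul_card_fib (L := L) hκ (by omega) g
  have h8 : (8 : ℤ) ≤ 2 ^ L := by
    calc (8 : ℤ) = 2 ^ 3 := by norm_num
      _ ≤ 2 ^ L := pow_le_pow_right₀ (by norm_num) hL
  have : (0 : ℤ) < (fib κ₀ L g).card := by linarith
  exact_mod_cast this

/-- Membership in the fibre. -/
theorem mem_fib_iff (g : Perm (ZMod 3)) (b : Fin L → Bool) : b ∈ fib κ₀ L g ↔ blockPerm κ₀ b = g := by
  unfold fib; simp

end Fibres

end DWalk

end Summit.QuantumAdvantage.AdviceFreeQNC0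

end
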